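import Mathlib
import Summits.Ventures.PercRepro2.Tail2DBlockCalc
import Summits.Ventures.PercRepro2.Tail2DHarrisSP
import Summits.Ventures.PercRepro2.Tail2DFlowOneBlocks
import Summits.Ventures.PercRepro2.Tail2DFlowOneStep01
import Summits.Ventures.PercRepro2.Tail2DParFin
import Summits.Ventures.PercRepro2.Tail2DParFinFlip
import Summits.Ventures.PercRepro2.Tail2DParFinTop
import Summits.Ventures.PercRepro2.Tail2DParFinDiag
import Summits.Ventures.PercRepro2.Tail2DParFinCount
import Summits.Ventures.PercRepro2.Tail2DParFinRelax
import Summits.Ventures.PercRepro2.Tail2DParFinSubTop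
import Summits.Ventures.PercRepro2.Tail2DParFinSubTopB
import Summits.Ventures.PercRepro2.Tail2DParFinFibres
import Summits.Ventures.PercRepro2.Tail2DOneChange
import Summits.Ventures.PercRepro2.Tail2DOneChangeB
import Summits.Ventures.PercRepro2.Tail2DOneChangeC
import Summits.Ventures.PercRepro2.Tail2DFourIdent
import Summits.Ventures.PercRepro2.Tail2DEig40Ident

/-!
# (SD) at `(4,0)` on `8` identical flow-one factors — target-type identities (T2)
(seat mine-b, cell pub-perc-repro2; conjectures/MINE-B.md §44)
-/

namespace Summit.Ventures.PercRepro2.Tail2D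

open V2Closure Finset

namespace IdentEig40

variable {Y : V2Closure.SP}

/-- the target identity at the type `(5,3)` -/
theorem tgt_5_3 (hY : FlowOne Y) (hR : 0 < (rSet Y).card) (w0 : Fin 8 → Ltr) (hr : nR 8 w0 = 5) (hb : nB 8 w0 = 3) :
    (if ocCom 8 4 0 w0 then (ratesN Y).ι w0 else 0)
      + ∑ j ∈ blueSet 8 w0, ((ratesN Y).f (Function.update w0 j Ltr.R) j
          + (if ocCom 8 4 0 (Function.update w0 j Ltr.R) then (ratesN Y).x (Function.update w0 j Ltr.R) j else 0))
      + ∑ l ∈ cSet 8 w0, (ratesN Y).x (Function.update w0 l Ltr.R) l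
      = (tailCount (parFin 8 (fun _ => Y)) 4 0 : ℚ) / (tailCount (parFin 8 (fun _ => Y)) (4 - 1) (0 + 1) : ℚ) := by
  have ha : (0 : ℚ) < aY Y := by unfold aY; exact_mod_cast hR
  have hc : (0 : ℚ) ≤ cY Y := by unfold cY; positivity
  have hD := dN_pos hR
  have hnC : nC 8 w0 = 0 := by have := nR_add_nB_add_nC 8 w0; omega
  rw [tgt_reduce, tailCountN_src hY, tailCountN_tgt hY]
  simp only [hr, hb, hnC, ιN, fN, xN]
  norm_num
  try unfold dN
  try field_simp
  try ring


/-- the target identity at the type `(3,4)` -/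
theorem tgt_3_4 (hY : FlowOne Y) (hR : 0 < (rSet Y).card) (w0 : Fin 8 → Ltr) (hr : nR 8 w0 = 3) (hb : nB 8 w0 = 4) :
    (if ocCom 8 4 0 w0 then (ratesN Y).ι w0 else 0)
      + ∑ j ∈ blueSet 8 w0, ((ratesN Y).f (Function.update w0 j Ltr.R) j
          + (if ocCom 8 4 0 (Function.update w0 j Ltr.R) then (ratesN Y).x (Function.update w0 j Ltr.R) j else 0))
      + ∑ l ∈ cSet 8 w0, (ratesN Y).x (Function.update w0 l Ltr.R) l
      = (tailCount (parFin 8 (fun _ => Y)) 4 0 : ℚ) / (tailCount (parFin 8 (fun _ => Y)) (4 - 1) (0 + 1) : ℚ) := by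
  have ha : (0 : ℚ) < aY Y := by unfold aY; exact_mod_cast hR
  have hc : (0 : ℚ) ≤ cY Y := by unfold cY; positivity
  have hD := dN_pos hR
  have hnC : nC 8 w0 = 1 := by have := nR_add_nB_add_nC 8 w0; omega
  rw [tgt_reduce, tailCountN_src hY, tailCountN_tgt hY]
  simp only [hr, hb, hnC, ιN, fN, xN]
  norm_num
  try unfold dN
  try field_simp
  try ring


/-- the target identity at the type `(4,4)` -/
theorem tgt_4_4 (hY : FlowOne Y) (hR : 0 < (rSet Y).card) (w0 : Fin 8 → Ltr) (hr : nR 8 w0 = 4) (hb : nB 8 w0 = 4) :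
    (if ocCom 8 4 0 w0 then (ratesN Y).ι w0 else 0)
      + ∑ j ∈ blueSet 8 w0, ((ratesN Y).f (Function.update w0 j Ltr.R) j
          + (if ocCom 8 4 0 (Function.update w0 j Ltr.R) then (ratesN Y).x (Function.update w0 j Ltr.R) j else 0))
      + ∑ l ∈ cSet 8 w0, (ratesN Y).x (Function.update w0 l Ltr.R) l
      = (tailCount (parFin 8 (fun _ => Y)) 4 0 : ℚ) / (tailCount (parFin 8 (fun _ => Y)) (4 - 1) (0 + 1) : ℚ) := by
  have ha : (0 : ℚ) < aY Y := by unfold aY; exact_mod_cast hR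
  have hc : (0 : ℚ) ≤ cY Y := by unfold cY; positivity
  have hD := dN_pos hR
  have hnC : nC 8 w0 = 0 := by have := nR_add_nB_add_nC 8 w0; omega
  rw [tgt_reduce, tailCountN_src hY, tailCountN_tgt hY]
  simp only [hr, hb, hnC, ιN, fN, xN]
  norm_num
  try unfold dN
  try field_simp
  try ring


/-- the target identity at the type `(3,5)` -/
theorem tgt_3_5 (hY : FlowOne Y) (hR : 0 < (rSet Y).card) (w0 : Fin 8 → Ltr) (hr : nR 8 w0 = 3) (hb : nB 8 w0 = 5) :
    (if ocCom 8 4 0 w0 then (ratesN Y).ι w0 else 0)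
      + ∑ j ∈ blueSet 8 w0, ((ratesN Y).f (Function.update w0 j Ltr.R) j
          + (if ocCom 8 4 0 (Function.update w0 j Ltr.R) then (ratesN Y).x (Function.update w0 j Ltr.R) j else 0))
      + ∑ l ∈ cSet 8 w0, (ratesN Y).x (Function.update w0 l Ltr.R) l
      = (tailCount (parFin 8 (fun _ => Y)) 4 0 : ℚ) / (tailCount (parFin 8 (fun _ => Y)) (4 - 1) (0 + 1) : ℚ) := by
  have ha : (0 : ℚ) < aY Y := by unfold aY; exact_mod_cast hR
  have hc : (0 : ℚ) ≤ cY Y := by unfold cY; positivity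
  have hD := dN_pos hR
  have hnC : nC 8 w0 = 0 := by have := nR_add_nB_add_nC 8 w0; omega
  rw [tgt_reduce, tailCountN_src hY, tailCountN_tgt hY]
  simp only [hr, hb, hnC, ιN, fN, xN]
  norm_num
  try unfold dN
  try field_simp
  try ring


end IdentEig40

end Summit.Ventures.PercRepro2.Tail2D
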